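import Literature.NumberTheory.LFunctions.WeilTwoPrimeDeflL2Base
import Literature.NumberTheory.LFunctions.WeilBlockRowsPZ
import HarnessLib

/-!
# Deflated two-prime certificate L2: the factored even inverse agrees with `D`, rows 112–119

`WeilCert.checkDnRow` (even block) for certificate L2, by `decide +kernel`. Pure proof file.
-/

noncomputable section

namespace Literature.NumberTheory.LFunctions

set_option maxHeartbeats 0 in
/-- Row 112 of `DnE/LsE` is row 112 of the even `D` (certificate L2). [folklore] -/
theorem checkDnRow0_112_weilCertDeflL2 : weilCertDeflL2Base.checkDnRow weilCertDeflL2DnE weilCertDeflL2LsE 0 112 = true := by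
  decide +kernel

set_option maxHeartbeats 0 in
/-- Row 113 of `DnE/LsE` is row 113 of the even `D` (certificate L2). [folklore] -/
theorem checkDnRow0_113_weilCertDeflL2 : weilCertDeflL2Base.checkDnRow weilCertDeflL2DnE weilCertDeflL2LsE 0 113 = true := by
  decide +kernel

set_option maxHeartbeats 0 in
/-- Row 114 of `DnE/LsE` is row 114 of the even `D` (certificate L2). [folklore] -/
theorem checkDnRow0_114_weilCertDeflL2 : weilCertDeflL2Base.checkDnRow weilCertDeflL2DnE weilCertDeflL2LsE 0 114 = true := by
  decide +kernel

set_option maxHeartbeats 0 in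
/-- Row 115 of `DnE/LsE` is row 115 of the even `D` (certificate L2). [folklore] -/
theorem checkDnRow0_115_weilCertDeflL2 : weilCertDeflL2Base.checkDnRow weilCertDeflL2DnE weilCertDeflL2LsE 0 115 = true := by
  decide +kernel

set_option maxHeartbeats 0 in
/-- Row 116 of `DnE/LsE` is row 116 of the even `D` (certificate L2). [folklore] -/
theorem checkDnRow0_116_weilCertDeflL2 : weilCertDeflL2Base.checkDnRow weilCertDeflL2DnE weilCertDeflL2LsE 0 116 = true := by
  decide +kernel

set_option maxHeartbeats 0 in
/-- Row 117 of `DnE/LsE` is row 117 of the even `D` (certificate L2). [folklore] -/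
theorem checkDnRow0_117_weilCertDeflL2 : weilCertDeflL2Base.checkDnRow weilCertDeflL2DnE weilCertDeflL2LsE 0 117 = true := by
  decide +kernel

set_option maxHeartbeats 0 in
/-- Row 118 of `DnE/LsE` is row 118 of the even `D` (certificate L2). [folklore] -/
theorem checkDnRow0_118_weilCertDeflL2 : weilCertDeflL2Base.checkDnRow weilCertDeflL2DnE weilCertDeflL2LsE 0 118 = true := by
  decide +kernel

set_option maxHeartbeats 0 in
/-- Row 119 of `DnE/LsE` is row 119 of the even `D` (certificate L2). [folklore] -/
theorem checkDnRow0_119_weilCertDeflL2 : weilCertDeflL2Base.checkDnRow weilCertDeflL2DnE weilCertDeflL2LsE 0 119 = true := by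
  decide +kernel


end Literature.NumberTheory.LFunctions
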